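import Summits.NavierStokesRegularity.NavierStokesRegularity.Theses.PalasekTowerBreakdown
import Summits.NavierStokesRegularity.FluidComputer.PalasekTowerGermHostDecoratedSlot

/-!
# `EpisodeBase` BY NAME for the LARGE-CARRIER hosts `U_b = decoratedBlob b a⋆`, every `b > 0`

Cell `ns-blowup`, seat `ns-blowup-ecbridge-3` (g3); GROUP C «BRIDGE SUPPORT» of the route
`PalasekTowerBreakdown`, crux `EpisodeBase` (item stmt-NavierStokesRegularity-19179, R2 of record:
`EpisodeBase ↔ ∃ S*, HostPreparationD (HostClass.exact S*) ∧ FirstEpisodeD (HostClass.exact S*)`).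
Over `FluidComputer/PalasekTowerGermHostDecoratedSlot.lean` (XVII: for every `b > 0` the decorated flat
blob `U_b` — carrier `Y₀•B_b` of arbitrary size, readouts on a mirror pair of half-amplitude tiny
decorations — fills ecbridge-4's weak slot, hence has a prepared pushed-germ host). LABEL: E–C typing
(KERNEL, proofs only, by name). WHAT THIS IS NOT: not Navier–Stokes evidence — the first conjunct of the
R2 witness for a one-parameter family of kernel-named hosts whose carriers are NOT small; the second
conjunct (the episode) is an OPEN hypothesis and presumably false for every `b` (a lone viscous vortex
blob does not raise its speed maximum by `Y₁/Y₀`); nothing about `RungG 1` or blow-up. HELPER for 19179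
(`--supports`), closes nothing.

* `palasekTowerBreakdown_hostPreparationD_large`: `∀ b > 0, ∀ c₄ ∈ (0, 1]`, host preparation in the
  singleton class of the pushed germ schedule of `U_b` — no further hypothesis;
* `palasekTowerBreakdown_episodeBase_of_large_firstEpisodeD`: `EpisodeBase ⇐` the episode of that host.

References: S. Palasek, arXiv:2605.13827 §3.3, §4 [cite: Palasek2026ElementaryModel, §4].
-/

noncomputable section

-- `Summit.<Summit>.<Problem>` is the tree's mandated summit-side namespace (CONVENTIONS §2); for this
-- single-conjunct summit the two coincide, so the duplicate is deliberate.
set_option linter.dupNamespace false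

namespace Summit.NavierStokesRegularity.NavierStokesRegularity.Theorems

open Set Function
open Summit.NavierStokesRegularity.FluidComputer.PalasekTowerClayBridge
open Summit.NavierStokesRegularity.FluidComputer.PalasekTowerClayBridge.Germ
open Literature.Analysis.FluidPDE

/-- **HOST PREPARATION FOR A CARRIER OF EVERY SIZE** (first conjunct of the R2 witness, kernel-named,
no hypothesis beyond `b > 0`, `c₄ ∈ (0, 1]`). [cite: Palasek2026ElementaryModel, §3.3] -/
theorem palasekTowerBreakdown_hostPreparationD_large {b : ℝ} (hb : 0 < b) {c₄ : ℝ} (hc₄ : 0 < c₄)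
    (hc₄' : c₄ ≤ 1) :
    HostPreparationD (HostClass.exact ((levelZeroDataWeak_large hb).schedule hc₄ hc₄')) :=
  hostPreparationD_large hb hc₄ hc₄'

/-- **`EpisodeBase` from the EPISODE of a large-carrier host.** [cite: Palasek2026ElementaryModel, §4] -/
theorem palasekTowerBreakdown_episodeBase_of_large_firstEpisodeD {b : ℝ} (hb : 0 < b) {c₄ : ℝ}
    (hc₄ : 0 < c₄) (hc₄' : c₄ ≤ 1)
    (hF : FirstEpisodeD (HostClass.exact ((levelZeroDataWeak_large hb).schedule hc₄ hc₄'))) :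
    Summit.NavierStokesRegularity.NavierStokesRegularity.Theses.PalasekTowerBreakdown.EpisodeBase :=
  episodeBaseG_of_firstEpisodeD_large hb hc₄ hc₄' hF

end Summit.NavierStokesRegularity.NavierStokesRegularity.Theorems

end
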